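import Literature.MathematicalPhysics.QuantumFieldTheory.King1986.SlicePropagatorStatements

/-!
# BalabanUVNodes ∕ N18 — SMEARED SLICE LETTERS (volume gain on the diagonal): King's printed Propositions 3.7 (3.63) and
# 3.9 (3.73) WITH BACKGROUND, read as hypothesis schemas (`King1986.SlicePropagator.Prop37Printed ∕ Prop39Printed`), smeared
# against nonnegative cube-pair weights and summed over the slices (2.17), give block-level decay letters `C·B·e^{−δ₀ r}` and
# two-run rate letters `(C·B)·(L^{−γ})^k·e^{−δ₀ r}` for EVERY pair of cubes — coincident and adjacent cubes included
# (Track A, DAG node N18 = NE5 `T4OutputRate.NE5 EA EB W κ θ C₅` :211; director-ym R134 row n18 s3 «King-model transfer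
# `N18KingModelTorus` (κ, C₅ from (d, L, a, m², γ)) → `TwoRunTorusNE5Final*`», dag-lead DEDUP-232 clause s3″ «U-READING BY
# NAME, CUBE-PAIR SMEARED (diagonal included)»; module 10a of seat pub-ymgap-dag-n18-e, the letters; module 10b
# `BalabanUVNodesN18SmearedSliceReadouts` feeds them to the N18 slots)

HONEST FRAMING.  Count-neutral kernel bookkeeping (seat pub-ymgap-dag-n18-e g6, strategy s3; `--supports` K3′
`SpineGivenEndpointR12`, helper).  The inputs are the HYPOTHESIS SCHEMAS `Prop37Printed D C δ₀` and `Prop39Printed T C δ₀ γ` —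
C. King's Propositions 3.7 and 3.9 for the U(1)-Higgs model in `d = 2, 3` WITH a regular background `A` ([King1986] pp. 663,
665; printed AND proved in print, §4 there), typed verbatim over ABSTRACT slice ∕ two-spacing data by the cell's literature seat
(`King1986/SlicePropagatorStatements.lean`, FILE C).  This file CONSUMES the schemas by name; it proves nothing of King's and
nothing of Bałaban's: NOT the covariant propagators `G_k(U)` of [Balaban1985BackgroundPropagators], NOT Bałaban's one-step
outputs `E^{(j)}(X; g, U)` of [Balaban1987RG1] (0.24), for which NE5 is NOT IN PRINT and has no tree producer (NODE O instance
0∕1); NOT an `A = 0` instance of the schemas (the tree's `A = 0` King material reads the massive minimiser kernels, not the slice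
decomposition — `N18KingModel*`); NOT a node discharge; nothing continuum ∕ ℝ⁴ ∕ OS ∕ mass-gap ∕ Clay.  THEOREMS ONLY: 0 `def`,
0 `sorry`, standard axioms.  The statements and proofs of §§1–3 re-home, under the route namespace and with the names of its
hygiene line, the farm-checked memo sketch of the cell's lens seat (`ym-lens-BalabanUVNodes-transfer` g4, card T6′,
`LensTransferSketch4.lean` §1, sha16 a9843be344f22ed2 — «never to be landed as is: a prover re-homes what it needs»); §4 is new.

THE POINT.  The N18 slots that read King's (3.73) are BLOCK-indexed and include the diagonal: `N18KingModelLineReadouts.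
ne5_reFunctional_of_fieldCubePairs` (`hG` over ALL pairs `X.2.1 ×ˢ X.2.1` of cubes of a domain), `N18KingModelScales.
ne5_of_threeFactorRates` ∕ `N18VertexGraphBrackets.ne5_of_vertexGraphRates` (`hdC ∀ z w`).  Read POINTWISE, the slice sum
(2.17) `Σ_{j<k}` of (3.73)'s right-hand side `C·L^{−γk}·(L^jη)^{2−d−γ}·e^{−δ₀|x−y|∕(L^jη)}` diverges on the diagonal
(`Σ_j (L^jη)^{2−d−γ} ~ η^{2−d−γ}`; King's own device there is power counting, p. 665).  SMEARED FIRST against nonnegative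
weights `w` on the fine point pairs of a pair of unit cubes that obey the VOLUME BOUND `Σ w·e^{−δ₀|x−y|∕(2L^jη)} ≤ B·(L^jη)^d`
(a Riemann sum at scale `L^jη ≥ η`; on the torus it is `N18KingModelBlockMeans.gaussianBlockVolume_le`, p484568), and SUMMED
SECOND, the exponent becomes `(2 − d − γ) + d = 2 − γ ≥ 1` and the slice sum is a convergent geometric series `≤ 1`
uniformly in `k`, the located decay `e^{−δ₀ r}` being kept from the other half of the exponential for any `r ≥ 0`:
* §1 `rpow_sliceSum_le_aux` ∕ `rpow_sliceSum_le` ∕ `rpow_sliceSum_le_one` — `Σ_{j<k} (ηL^j)^b ≤ (½)^b∕(1 − L^{−b}) ≤ 1`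
  (`b ≥ 1`, `L ≥ 2`, slices `≤ ½`);
* §2 `smeared_letter_of_slice_letters` — ABSTRACT: per-slice pointwise letters `A·s_j^a·e^{−δρ∕s_j}` (ANY real `a`), a volume
  bound `Σ_p w_p e^{−δρ_p∕(2s_j)} ≤ B·s_j^{dvol}` and `Σ_j s_j^{a+dvol} ≤ Λ` ⟹ `|Σ_j Σ_p w_p g_j(p)| ≤ A·B·Λ·e^{−δr}` on `ρ ≥ r ≥ 0`;
* §3 BY NAME FROM FILE C: `sliceKernels_slice_le_half`; **`sliceKernels_smearedSupLetter_of_prop37`** ((3.63) first clause,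
  `a = 2 − d`: the one-run ENVELOPE of the smeared slice sum, `C·B·e^{−δ₀ r}` — the `hCA`∕`hCB`∕`hG`-envelope letters at block
  level); **`twoSpacing_smearedLetter_of_prop39`** ∕ **`twoSpacing_smearedNE5Letter_of_prop39`** ((3.73) first clause, `γ ≤ 1`:
  the two-run RATE of the smeared slice sum, `C·L^{−γk}·B·e^{−δ₀ r} = (C·B)·(L^{−γ})^k·e^{−δ₀ r}` — the `hdC`∕`hG` letter, card T6′);
* §4 **`twoSpacing_smearedSupLetter_hi`** — the FINE run's envelope from the coarse run's (3.63) (constant `C`) plus the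
  rate (3.73) (constant `C′`): `(C + C′·L^{−γk})·B·e^{−δ₀ r} ≤ (C + C′)·B·e^{−δ₀ r}` (`0 ≤ γ`), so that no Proposition-3.7 schema
  ON THE FINE DATA is consumed (see HONEST SCOPE (ii)); `theta_pos_le_one` (`θ = L^{−γ} ∈ (0, 1]` for `γ ≥ 0`, `L ≥ 1`).
WHAT THIS DOES NOT DO ∕ HONEST SCOPE.  (i) The gradient, contour and Hölder clauses of (3.63)∕(3.73) are carried inside the
schemas and NOT consumed (the gradient clause smeared needs `Λ = (½)^{1−γ}∕(1 − L^{−(1−γ)})`, `γ < 1`, by `rpow_sliceSum_le`;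
no consumer asks).  (ii) FILE C indexes the fine data `T.hi` as level-`(k+n)` slice data (`hi.slice j = L^jη′`) while
`Prop39Printed` pairs `T.hi.G j` with `T.lo.G j` at the COARSE length `L^jη`, as (3.73) prints (King re-indexes the fine slices
`−n ≤ j ≤ k − 1`, p. 663); this file reads `T.hi.G j`, `j < k`, exactly as `Prop39Printed` does and never through
`Prop37Printed T.hi`.  (iii) The volume bound is a DISPLAYED hypothesis (`SliceKernels` carries abstract point types and no
measure); its torus instance is module 7's `gaussianBlockVolume_le`.  (iv) No instance of the schemas is constructed.

Sources: C. King, Commun. Math. Phys. **102** (1986) 649–677 [King1986] — (2.13)–(2.17) p. 653, Thm 3.3 p. 655 (stated;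
(3.6)–(3.8) p. 656), Prop. 3.7 (3.63) p. 663, p. 664 («x′ ∈ B^n(x)»), Prop. 3.9 (3.73) p. 665 (+ L17–21: power counting for
the replaced line), p. 674 («To prove Proposition 3.9 we use the representation (2.17) and Proposition 3.8»); T. Bałaban,
Commun. Math. Phys. **109** (1987) 249–301 [Balaban1987RG1] — (0.25) p. 257, Thm 1 p. 259.  LINEAGE ERRATUM (ref-I READ-54
NIT-L1): the locator «King Thm 3.3 p.658» in `N18KingModelDecay∕OneRun∕TopPieceDeriv∕Torus∕Vertices` should read «Thm 3.3
p.655 ((3.6)–(3.8) p.656)»; p. 658 carries the vertices (3.22)–(3.26).  No claim about the mass gap.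
-/

noncomputable section

namespace Summit.QuantumFields.YangMills.BalabanUVNodes.N18SmearedSliceLetters

open Real Finset
open Literature.MathematicalPhysics.QuantumFieldTheory.King1986.ContinuumLimit (eps eps_pos)
open Literature.MathematicalPhysics.QuantumFieldTheory.King1986.SlicePropagator
  (SliceKernels TwoSpacing Prop37Printed Prop39Printed)

/-! ## §1 Geometric slice sums with a positive real power -/

section SliceSums

/-- Geometric slice sum, inductive form: for `L > 1`, `η > 0`, `b > 0` and every `k`,
`Σ_{j<k} (ηL^j)^b ≤ (ηL^k)^b · L^{−b}∕(1 − L^{−b})`. [folklore] -/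
theorem rpow_sliceSum_le_aux (L η b : ℝ) (hL : 1 < L) (hη : 0 < η) (hb : 0 < b) (k : ℕ) :
    ∑ j ∈ Finset.range k, (η * L ^ j) ^ b ≤ (η * L ^ k) ^ b * (L ^ (-b) / (1 - L ^ (-b))) := by
  have hL0 : 0 < L := by linarith
  have ht0 : 0 < L ^ (-b) := Real.rpow_pos_of_pos hL0 _
  have ht1 : L ^ (-b) < 1 := Real.rpow_lt_one_of_one_lt_of_neg hL (by linarith)
  have h1t : 0 < 1 - L ^ (-b) := by linarith
  have key : ∀ k : ℕ, (η * L ^ (k + 1)) ^ b * L ^ (-b) = (η * L ^ k) ^ b := by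
    intro k
    have hx : 0 ≤ η * L ^ k := by positivity
    rw [pow_succ, ← mul_assoc, Real.mul_rpow hx hL0.le, mul_assoc, ← Real.rpow_add hL0,
      add_neg_cancel, Real.rpow_zero, mul_one]
  induction k with
  | zero => simp only [Finset.range_zero, Finset.sum_empty]; positivity
  | succ k ih =>
    rw [Finset.sum_range_succ]
    have hstep : (η * L ^ k) ^ b * (L ^ (-b) / (1 - L ^ (-b))) + (η * L ^ k) ^ b
        = (η * L ^ (k + 1)) ^ b * (L ^ (-b) / (1 - L ^ (-b))) := by
      rw [← key k]; field_simp; ring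
    calc ∑ j ∈ Finset.range k, (η * L ^ j) ^ b + (η * L ^ k) ^ b
        ≤ (η * L ^ k) ^ b * (L ^ (-b) / (1 - L ^ (-b))) + (η * L ^ k) ^ b := by linarith
      _ = (η * L ^ (k + 1)) ^ b * (L ^ (-b) / (1 - L ^ (-b))) := hstep

/-- **Geometric slice sum with a positive real power.**  For `L ≥ 2`, `η > 0`, `b > 0` and all slices `ηL^j ≤ 1∕2` (`j < k`):
`Σ_{j<k} (ηL^j)^b ≤ (1∕2)^b∕(1 − L^{−b})`, uniformly in `k`. [folklore] -/
theorem rpow_sliceSum_le (L η b : ℝ) (k : ℕ) (hL : 2 ≤ L) (hη : 0 < η) (hb : 0 < b)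
    (hsub : ∀ j < k, η * L ^ j ≤ 1 / 2) :
    ∑ j ∈ Finset.range k, (η * L ^ j) ^ b ≤ (1 / 2) ^ b / (1 - L ^ (-b)) := by
  have hL1 : 1 < L := by linarith
  have hL0 : 0 < L := by linarith
  have ht1 : L ^ (-b) < 1 := Real.rpow_lt_one_of_one_lt_of_neg hL1 (by linarith)
  have h1t : 0 < 1 - L ^ (-b) := by linarith
  cases k with
  | zero => simp only [Finset.range_zero, Finset.sum_empty]; positivity
  | succ m =>
    have haux := rpow_sliceSum_le_aux L η b hL1 hη hb (m + 1)
    have hx : 0 ≤ η * L ^ m := by positivity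
    have key : (η * L ^ (m + 1)) ^ b * L ^ (-b) = (η * L ^ m) ^ b := by
      rw [pow_succ, ← mul_assoc, Real.mul_rpow hx hL0.le, mul_assoc, ← Real.rpow_add hL0,
        add_neg_cancel, Real.rpow_zero, mul_one]
    have hm : (η * L ^ m) ^ b ≤ (1 / 2) ^ b :=
      Real.rpow_le_rpow hx (hsub m (Nat.lt_succ_self m)) hb.le
    calc ∑ j ∈ Finset.range (m + 1), (η * L ^ j) ^ b
        ≤ (η * L ^ (m + 1)) ^ b * (L ^ (-b) / (1 - L ^ (-b))) := haux
      _ = (η * L ^ m) ^ b / (1 - L ^ (-b)) := by rw [mul_div_assoc', key]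
      _ ≤ (1 / 2) ^ b / (1 - L ^ (-b)) := by gcongr

/-- … and for `b ≥ 1` (the case `a + d = 2 − γ`, `γ ≤ 1`, of the `G`-clause of (3.73), and `a + d = 2` of (3.63)):
`Σ_{j<k} (ηL^j)^b ≤ 1`. [folklore] -/
theorem rpow_sliceSum_le_one (L η b : ℝ) (k : ℕ) (hL : 2 ≤ L) (hη : 0 < η) (hb : 1 ≤ b)
    (hsub : ∀ j < k, η * L ^ j ≤ 1 / 2) :
    ∑ j ∈ Finset.range k, (η * L ^ j) ^ b ≤ 1 := by
  have hL1 : 1 ≤ L := by linarith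
  have h := rpow_sliceSum_le L η b k hL hη (by linarith) hsub
  -- `(1/2)^b ≤ 1/2` and `L^{−b} ≤ L^{−1} ≤ 1/2`
  have hnum : (1 / 2 : ℝ) ^ b ≤ 1 / 2 := by
    calc (1 / 2 : ℝ) ^ b ≤ (1 / 2 : ℝ) ^ (1 : ℝ) :=
          Real.rpow_le_rpow_of_exponent_ge (by norm_num) (by norm_num) hb
      _ = 1 / 2 := Real.rpow_one _
  have hden : L ^ (-b) ≤ 1 / 2 := by
    calc L ^ (-b) ≤ L ^ (-(1 : ℝ)) := Real.rpow_le_rpow_of_exponent_le hL1 (by linarith)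
      _ = L⁻¹ := Real.rpow_neg_one L
      _ ≤ 1 / 2 := by rw [one_div]; exact inv_anti₀ (by norm_num) hL
  have h1t : (1 / 2 : ℝ) ≤ 1 - L ^ (-b) := by linarith
  calc ∑ j ∈ Finset.range k, (η * L ^ j) ^ b ≤ (1 / 2) ^ b / (1 - L ^ (-b)) := h
    _ ≤ (1 / 2) / (1 / 2) := by gcongr
    _ = 1 := by norm_num

end SliceSums

/-! ## §2 The abstract volume-gain lemma: smeared letters from pointwise slice letters -/

section Abstract

/-- **SMEARED LETTER FROM POINTWISE SLICE LETTERS (volume gain).**  Abstract data: slices `s_j` with `0 < s_j ≤ 1∕2` (`j < k`), a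
finite support `T` of «points» `p` (fine point pairs of a cube pair) with weights `w_p ≥ 0` and a «distance» `ρ_p ≥ r ≥ 0` on the
support, per-slice pointwise letters `|g_j(p)| ≤ A·s_j^a·exp(−δρ_p∕s_j)` (`a` any real: UV-singular prefactors allowed), the
VOLUME BOUND `Σ_{p∈T} w_p·exp(−δρ_p∕(2s_j)) ≤ B·s_j^{dvol}` and the slice sum `Σ_{j<k} s_j^{a+dvol} ≤ Λ`.  Then
`|Σ_{j<k} Σ_{p∈T} w_p·g_j(p)| ≤ A·B·Λ·exp(−δr)` — half of each exponential gives `e^{−δr}` (`ρ∕(2s) ≥ ρ ≥ r`), the other half is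
eaten by the volume bound (King p. 674: *"To prove Proposition 3.9 we use the representation (2.17) and Proposition 3.8"* —
the slice bookkeeping, here against block weights). [cite: King1986, (2.17) p.653 and p.674] -/
theorem smeared_letter_of_slice_letters {P : Type*} (s : ℕ → ℝ) (k : ℕ) (g : ℕ → P → ℝ) (w ρ : P → ℝ)
    (T : Finset P) (A B Λ δ a dvol r : ℝ)
    (hs : ∀ j < k, 0 < s j ∧ s j ≤ 1 / 2) (hw : ∀ p ∈ T, 0 ≤ w p) (hA : 0 ≤ A) (hB : 0 ≤ B) (hδ : 0 < δ)
    (hr0 : 0 ≤ r) (hr : ∀ p ∈ T, r ≤ ρ p)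
    (hg : ∀ j < k, ∀ p ∈ T, |g j p| ≤ A * (s j) ^ a * Real.exp (-(δ * ρ p / s j)))
    (hvol : ∀ j < k, ∑ p ∈ T, w p * Real.exp (-(δ * ρ p / (2 * s j))) ≤ B * (s j) ^ dvol)
    (hsum : ∑ j ∈ Finset.range k, (s j) ^ (a + dvol) ≤ Λ) :
    |∑ j ∈ Finset.range k, ∑ p ∈ T, w p * g j p| ≤ A * B * Λ * Real.exp (-(δ * r)) := by
  -- per slice
  have hslice : ∀ j ∈ Finset.range k,
      |∑ p ∈ T, w p * g j p| ≤ A * B * Real.exp (-(δ * r)) * (s j) ^ (a + dvol) := by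
    intro j hj
    rw [Finset.mem_range] at hj
    obtain ⟨hs0, hs1⟩ := hs j hj
    have hsa : 0 ≤ (s j) ^ a := Real.rpow_nonneg hs0.le _
    calc |∑ p ∈ T, w p * g j p| ≤ ∑ p ∈ T, |w p * g j p| := Finset.abs_sum_le_sum_abs _ _
      _ ≤ ∑ p ∈ T, w p * (A * (s j) ^ a * Real.exp (-(δ * r)) * Real.exp (-(δ * ρ p / (2 * s j)))) := by
          apply Finset.sum_le_sum
          intro p hp
          rw [abs_mul, abs_of_nonneg (hw p hp)]
          apply mul_le_mul_of_nonneg_left _ (hw p hp)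
          have hρ : r ≤ ρ p := hr p hp
          have hρ0 : 0 ≤ ρ p := le_trans hr0 hρ
          -- split the exponential
          have hsplit : Real.exp (-(δ * ρ p / s j))
              = Real.exp (-(δ * ρ p / (2 * s j))) * Real.exp (-(δ * ρ p / (2 * s j))) := by
            rw [← Real.exp_add]; congr 1; field_simp; ring
          have hhalf : Real.exp (-(δ * ρ p / (2 * s j))) ≤ Real.exp (-(δ * r)) := by
            apply Real.exp_le_exp.mpr
            have h2s : 0 < 2 * s j := by linarith
            have : δ * r ≤ δ * ρ p / (2 * s j) := by
              rw [le_div_iff₀ h2s]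
              calc δ * r * (2 * s j) ≤ δ * r * 1 := by
                    apply mul_le_mul_of_nonneg_left (by linarith) (by positivity)
                _ = δ * r := mul_one _
                _ ≤ δ * ρ p := by apply mul_le_mul_of_nonneg_left hρ hδ.le
            linarith
          calc |g j p| ≤ A * (s j) ^ a * Real.exp (-(δ * ρ p / s j)) := hg j hj p hp
            _ = A * (s j) ^ a * (Real.exp (-(δ * ρ p / (2 * s j))) * Real.exp (-(δ * ρ p / (2 * s j)))) := by
                rw [hsplit]
            _ ≤ A * (s j) ^ a * (Real.exp (-(δ * r)) * Real.exp (-(δ * ρ p / (2 * s j)))) := by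
                gcongr
            _ = A * (s j) ^ a * Real.exp (-(δ * r)) * Real.exp (-(δ * ρ p / (2 * s j))) := by ring
      _ = A * (s j) ^ a * Real.exp (-(δ * r)) * ∑ p ∈ T, w p * Real.exp (-(δ * ρ p / (2 * s j))) := by
          rw [Finset.mul_sum]
          exact Finset.sum_congr rfl fun p _ => by ring
      _ ≤ A * (s j) ^ a * Real.exp (-(δ * r)) * (B * (s j) ^ dvol) := by
          apply mul_le_mul_of_nonneg_left (hvol j hj) (by positivity)
      _ = A * B * Real.exp (-(δ * r)) * ((s j) ^ a * (s j) ^ dvol) := by ring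
      _ = A * B * Real.exp (-(δ * r)) * (s j) ^ (a + dvol) := by rw [← Real.rpow_add hs0]
  calc |∑ j ∈ Finset.range k, ∑ p ∈ T, w p * g j p|
      ≤ ∑ j ∈ Finset.range k, |∑ p ∈ T, w p * g j p| := Finset.abs_sum_le_sum_abs _ _
    _ ≤ ∑ j ∈ Finset.range k, A * B * Real.exp (-(δ * r)) * (s j) ^ (a + dvol) := Finset.sum_le_sum hslice
    _ = A * B * Real.exp (-(δ * r)) * ∑ j ∈ Finset.range k, (s j) ^ (a + dvol) := by rw [Finset.mul_sum]
    _ ≤ A * B * Real.exp (-(δ * r)) * Λ := by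
        apply mul_le_mul_of_nonneg_left hsum (by positivity)
    _ = A * B * Λ * Real.exp (-(δ * r)) := by ring

end Abstract

/-! ## §3 By name from FILE C: the smeared letters of (3.63) and (3.73), diagonal included -/

section FromPrint

variable {d : ℕ}

/-- All slices of level-`k` data are `≤ 1∕2` for `L ≥ 2`: `L^jη = L^{j−k} ≤ L^{−1}`. [cite: King1986, (3.63) p.663] -/
theorem sliceKernels_slice_le_half (D : SliceKernels d) (hL : 2 ≤ D.L) {j : ℕ} (hj : j < D.k) :
    D.η * (D.L : ℝ) ^ j ≤ 1 / 2 := by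
  have hL2 : (2 : ℝ) ≤ D.L := by exact_mod_cast hL
  unfold SliceKernels.η eps
  obtain ⟨m, hm⟩ := Nat.exists_eq_add_of_lt hj
  rw [hm, show j + m + 1 = j + (m + 1) by ring, pow_add, mul_inv, mul_assoc, mul_comm ((D.L:ℝ) ^ (m+1))⁻¹,
    ← mul_assoc, inv_mul_cancel₀ (by positivity), one_mul]
  have hLm : (2 : ℝ) ≤ (D.L : ℝ) ^ (m + 1) := by
    calc (2 : ℝ) ≤ D.L := hL2
      _ = (D.L : ℝ) ^ 1 := (pow_one _).symm
      _ ≤ (D.L : ℝ) ^ (m + 1) := pow_le_pow_right₀ (by linarith) (by omega)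
  rw [one_div]
  exact inv_anti₀ (by norm_num) hLm

/-- The slices of level-`k` data are positive and `≤ 1∕2` (`L ≥ 2`), in the form `smeared_letter_of_slice_letters` consumes.
[cite: King1986, (3.63) p.663] -/
theorem sliceKernels_slice_mem (D : SliceKernels d) (hL : 2 ≤ D.L) :
    ∀ j < D.k, 0 < D.slice j ∧ D.slice j ≤ 1 / 2 := fun j hj =>
  ⟨D.slice_pos (by omega) j, by rw [D.slice_eq j]; exact sliceKernels_slice_le_half D hL hj⟩

/-- The slice sum `Σ_{j<k} (L^jη)^{a + d} ≤ 1` of level-`k` data whenever `a + d ≥ 1` (`L ≥ 2`): the volume `(L^jη)^d` beats a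
UV prefactor `(L^jη)^a` as soon as `a ≥ 1 − d`. [cite: King1986, (2.17) p.653] -/
theorem sliceKernels_sliceSum_le_one (D : SliceKernels d) (hL : 2 ≤ D.L) {a : ℝ} (ha : 1 ≤ a + d) :
    ∑ j ∈ Finset.range D.k, (D.slice j) ^ (a + d) ≤ 1 := by
  have hLr : (2 : ℝ) ≤ D.L := by exact_mod_cast hL
  have hη : 0 < D.η := eps_pos (by omega) D.k
  have h1 := rpow_sliceSum_le_one (D.L : ℝ) D.η (a + d) D.k hLr hη ha
    (fun j hj => sliceKernels_slice_le_half D hL hj)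
  calc ∑ j ∈ Finset.range D.k, (D.slice j) ^ (a + d)
      = ∑ j ∈ Finset.range D.k, (D.η * (D.L : ℝ) ^ j) ^ (a + d) :=
        Finset.sum_congr rfl fun j _ => by rw [D.slice_eq j]
    _ ≤ 1 := h1

/-- **(3.63) SMEARED — THE ONE-RUN ENVELOPE OF THE SMEARED SLICE SUM, DIAGONAL INCLUDED.**  King's Proposition 3.7 first clause
WITH BACKGROUND (the schema `Prop37Printed D C δ₀`, `0 ≤ C`, `0 < δ₀`, `L ≥ 2`), read at the images `(π₁ p, π₂ p)` of ANY finite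
family `T` of «points» `p` (fine point pairs of a pair of cubes, through any maps `π₁, π₂` into the sites) with weights `w ≥ 0`
at distance `≥ r ≥ 0` obeying the VOLUME BOUND `Σ w·exp(−δ₀·|π₁p − π₂p|∕(2L^jη)) ≤ B·(L^jη)^d` for every slice, and summed over
the slices `j < k` of (2.17): `|Σ_{j<k} Σ_p w_p·G^η_{(j)}(π₁ p, π₂ p)| ≤ C·B·exp(−δ₀ r)` — for COINCIDENT and ADJACENT cubes too
(`r = 0`): the exponent `(2 − d) + d = 2 ≥ 1`. [cite: King1986, Prop 3.7 (3.63) p.663, (2.17) p.653] -/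
theorem sliceKernels_smearedSupLetter_of_prop37 (D : SliceKernels d) (hL : 2 ≤ D.L) {C δ₀ : ℝ} (hC : 0 ≤ C)
    (hδ₀ : 0 < δ₀) (h37 : Prop37Printed D C δ₀) {P : Type*} (T : Finset P) (π₁ π₂ : P → D.S) (w : P → ℝ)
    (hw : ∀ p ∈ T, 0 ≤ w p) {B r : ℝ} (hB : 0 ≤ B) (hr0 : 0 ≤ r) (hr : ∀ p ∈ T, r ≤ D.dist (π₁ p) (π₂ p))
    (hvol : ∀ j < D.k, ∑ p ∈ T, w p * Real.exp (-(δ₀ * D.dist (π₁ p) (π₂ p) / (2 * D.slice j)))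
      ≤ B * (D.slice j) ^ (d : ℝ)) :
    |∑ j ∈ Finset.range D.k, ∑ p ∈ T, w p * D.G j (π₁ p) (π₂ p)| ≤ C * B * Real.exp (-(δ₀ * r)) := by
  have hsum := sliceKernels_sliceSum_le_one D hL (a := (2 : ℝ) - d) (by linarith)
  have hmain := smeared_letter_of_slice_letters (P := P) D.slice D.k (fun j p => D.G j (π₁ p) (π₂ p)) w
    (fun p => D.dist (π₁ p) (π₂ p)) T C B 1 δ₀ ((2 : ℝ) - d) d r (sliceKernels_slice_mem D hL) hw hC hB hδ₀ hr0 hr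
    ?_ hvol hsum
  · calc _ ≤ _ := hmain
      _ = _ := by ring
  intro j hj p _
  have h := ((h37 j (by omega)).1 (π₁ p) (π₂ p)).1
  have hexp : Real.exp (-(δ₀ * (D.slice j)⁻¹ * D.dist (π₁ p) (π₂ p)))
      = Real.exp (-(δ₀ * D.dist (π₁ p) (π₂ p) / D.slice j)) := by
    congr 1; rw [div_eq_mul_inv]; ring
  rw [hexp] at h
  exact h

/-- **(3.73) SMEARED — THE TWO-RUN RATE OF THE SMEARED SLICE SUM, DIAGONAL INCLUDED (card T6′).**  King's Proposition 3.9 first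
clause WITH BACKGROUND (the schema `Prop39Printed T C δ₀ γ`, `0 ≤ C`, `γ ≤ 1`, `d` the dimension, `L ≥ 2`), smeared against ANY
finite family `Tpq` of fine point pairs `(x′, y′)` of `T_{η′}` with weights `w ≥ 0` whose blocked images are at `lo`-distance
`≥ r ≥ 0` and obey the VOLUME BOUND `Σ w·exp(−δ₀·|x − y|∕(2L^jη)) ≤ B·(L^jη)^d` for every slice, and summed over the slices
`j < k` of (2.17): `|Σ_{j<k} Σ_{(x′,y′)} w(x′,y′)·(G^{η′}_{(j)}(x′,y′) − G^η_{(j)}(x,y))| ≤ C·L^{−γk}·B·exp(−δ₀ r)` — uniformly in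
`k`, valid for COINCIDENT and ADJACENT cube pairs (`r = 0`): the volume `(L^jη)^d` beats the UV prefactor `(L^jη)^{2−d−γ}`,
`Σ_j (L^jη)^{2−γ} ≤ 1`. [cite: King1986, Prop 3.9 (3.73) p.665, (2.17) p.653] -/
theorem twoSpacing_smearedLetter_of_prop39 (T : TwoSpacing d) (hL : 2 ≤ T.lo.L)
    {C δ₀ γ : ℝ} (hC : 0 ≤ C) (hδ₀ : 0 < δ₀) (hγ1 : γ ≤ 1) (h39 : Prop39Printed T C δ₀ γ)
    (Tpq : Finset (T.hi.S × T.hi.S)) (w : T.hi.S × T.hi.S → ℝ) (hw : ∀ p ∈ Tpq, 0 ≤ w p)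
    {B r : ℝ} (hB : 0 ≤ B) (hr0 : 0 ≤ r) (hr : ∀ p ∈ Tpq, r ≤ T.lo.dist (T.pt p.1) (T.pt p.2))
    (hvol : ∀ j < T.lo.k, ∑ p ∈ Tpq, w p * Real.exp (-(δ₀ * T.lo.dist (T.pt p.1) (T.pt p.2) / (2 * T.lo.slice j)))
      ≤ B * (T.lo.slice j) ^ (d : ℝ)) :
    |∑ j ∈ Finset.range T.lo.k, ∑ p ∈ Tpq, w p * (T.hi.G j p.1 p.2 - T.lo.G j (T.pt p.1) (T.pt p.2))|
      ≤ C * (T.lo.L : ℝ) ^ (-(γ * T.lo.k)) * B * Real.exp (-(δ₀ * r)) := by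
  have hA : 0 ≤ C * (T.lo.L : ℝ) ^ (-(γ * T.lo.k)) := by positivity
  have hsum := sliceKernels_sliceSum_le_one T.lo hL (a := (2 : ℝ) - d - γ) (by linarith)
  have hmain := smeared_letter_of_slice_letters (P := T.hi.S × T.hi.S) T.lo.slice T.lo.k
    (fun j p => T.hi.G j p.1 p.2 - T.lo.G j (T.pt p.1) (T.pt p.2)) w (fun p => T.lo.dist (T.pt p.1) (T.pt p.2))
    Tpq (C * (T.lo.L : ℝ) ^ (-(γ * T.lo.k))) B 1 δ₀ ((2 : ℝ) - d - γ) d r (sliceKernels_slice_mem T.lo hL) hw hA hB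
    hδ₀ hr0 hr ?_ hvol hsum
  · calc _ ≤ _ := hmain
      _ = _ := by ring
  -- the per-slice pointwise letters = (3.73) first clause, rewritten
  intro j hj p _
  have h := ((h39 j (by omega)).1 p.1 p.2).1
  have hexp : Real.exp (-(δ₀ * (T.lo.slice j)⁻¹ * T.lo.dist (T.pt p.1) (T.pt p.2)))
      = Real.exp (-(δ₀ * T.lo.dist (T.pt p.1) (T.pt p.2) / T.lo.slice j)) := by
    congr 1; rw [div_eq_mul_inv]; ring
  rw [hexp] at h
  exact h

/-- `L^{−γk} = (L^{−γ})^k` — King's printed rate factor as a power of `θ = L^{−γ}` (the `θ^{scale X}` of `T4OutputRate.NE5`).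
[cite: King1986, Prop 3.9 (3.73) p.665] -/
theorem rpow_neg_mul_natCast (L : ℕ) (γ : ℝ) (k : ℕ) :
    (L : ℝ) ^ (-(γ * k)) = ((L : ℝ) ^ (-γ)) ^ k := by
  rw [show (-(γ * (k : ℝ))) = (-γ) * (k : ℝ) by ring, Real.rpow_mul (Nat.cast_nonneg L), Real.rpow_natCast]

/-- The same in the N18 END's currency `C₅·θ^k·e^{−κ′r}` (`θ = L^{−γ}`, `κ′ = δ₀`, `C₅ = C·B`): the cube-pair smeared two-spacing
letter, diagonal pairs included. [cite: King1986, Prop 3.9 (3.73) p.665; Balaban1987RG1, (0.25) p.257] -/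
theorem twoSpacing_smearedNE5Letter_of_prop39 (T : TwoSpacing d) (hL : 2 ≤ T.lo.L)
    {C δ₀ γ : ℝ} (hC : 0 ≤ C) (hδ₀ : 0 < δ₀) (hγ1 : γ ≤ 1) (h39 : Prop39Printed T C δ₀ γ)
    (Tpq : Finset (T.hi.S × T.hi.S)) (w : T.hi.S × T.hi.S → ℝ) (hw : ∀ p ∈ Tpq, 0 ≤ w p)
    {B r : ℝ} (hB : 0 ≤ B) (hr0 : 0 ≤ r) (hr : ∀ p ∈ Tpq, r ≤ T.lo.dist (T.pt p.1) (T.pt p.2))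
    (hvol : ∀ j < T.lo.k, ∑ p ∈ Tpq, w p * Real.exp (-(δ₀ * T.lo.dist (T.pt p.1) (T.pt p.2) / (2 * T.lo.slice j)))
      ≤ B * (T.lo.slice j) ^ (d : ℝ)) :
    |∑ j ∈ Finset.range T.lo.k, ∑ p ∈ Tpq, w p * (T.hi.G j p.1 p.2 - T.lo.G j (T.pt p.1) (T.pt p.2))|
      ≤ (C * B) * ((T.lo.L : ℝ) ^ (-γ)) ^ T.lo.k * Real.exp (-(δ₀ * r)) := by
  have h := twoSpacing_smearedLetter_of_prop39 T hL hC hδ₀ hγ1 h39 Tpq w hw hB hr0 hr hvol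
  calc _ ≤ _ := h
    _ = _ := by rw [rpow_neg_mul_natCast]; ring

end FromPrint

/-! ## §4 The fine run's envelope without a schema on the fine data; the rate `θ = L^{−γ}` -/

section FineRun

variable {d : ℕ}

/-- `θ = L^{−γ} ∈ (0, 1]` for `L ≥ 1`, `γ ≥ 0` — the letters `0 ≤ θ`, `θ ≤ 1` every N18 slot asks of the rate.
[cite: King1986, Prop 3.9 (3.73) p.665] -/
theorem theta_pos_le_one {L : ℕ} (hL : 1 ≤ L) {γ : ℝ} (hγ : 0 ≤ γ) :
    0 < (L : ℝ) ^ (-γ) ∧ (L : ℝ) ^ (-γ) ≤ 1 := by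
  have hL1 : (1 : ℝ) ≤ L := by exact_mod_cast hL
  exact ⟨Real.rpow_pos_of_pos (by linarith) _, Real.rpow_le_one_of_one_le_of_nonpos hL1 (by linarith)⟩

/-- **THE FINE RUN'S ENVELOPE FROM THE COARSE RUN'S (3.63) AND THE RATE (3.73)** (no Proposition-3.7 schema on the fine data is
read — HONEST SCOPE (ii)): with `Prop37Printed T.lo C δ₀` and `Prop39Printed T C′ δ₀ γ` (`0 ≤ γ ≤ 1`), the smeared slice sum
of the FINE kernels obeys `|Σ_{j<k} Σ_{(x′,y′)} w·G^{η′}_{(j)}(x′,y′)| ≤ (C + C′)·B·exp(−δ₀ r)` (`|G′| ≤ |G| + |G′ − G|`,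
`L^{−γk} ≤ 1`). [cite: King1986, Prop 3.7 (3.63) p.663, Prop 3.9 (3.73) p.665] -/
theorem twoSpacing_smearedSupLetter_hi (T : TwoSpacing d) (hL : 2 ≤ T.lo.L) {C C' δ₀ γ : ℝ} (hC : 0 ≤ C)
    (hC' : 0 ≤ C') (hδ₀ : 0 < δ₀) (hγ0 : 0 ≤ γ) (hγ1 : γ ≤ 1) (h37 : Prop37Printed T.lo C δ₀)
    (h39 : Prop39Printed T C' δ₀ γ)
    (Tpq : Finset (T.hi.S × T.hi.S)) (w : T.hi.S × T.hi.S → ℝ) (hw : ∀ p ∈ Tpq, 0 ≤ w p)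
    {B r : ℝ} (hB : 0 ≤ B) (hr0 : 0 ≤ r) (hr : ∀ p ∈ Tpq, r ≤ T.lo.dist (T.pt p.1) (T.pt p.2))
    (hvol : ∀ j < T.lo.k, ∑ p ∈ Tpq, w p * Real.exp (-(δ₀ * T.lo.dist (T.pt p.1) (T.pt p.2) / (2 * T.lo.slice j)))
      ≤ B * (T.lo.slice j) ^ (d : ℝ)) :
    |∑ j ∈ Finset.range T.lo.k, ∑ p ∈ Tpq, w p * T.hi.G j p.1 p.2| ≤ (C + C') * B * Real.exp (-(δ₀ * r)) := by
  have hlo := sliceKernels_smearedSupLetter_of_prop37 T.lo hL hC hδ₀ h37 Tpq (fun p => T.pt p.1) (fun p => T.pt p.2)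
    w hw hB hr0 hr hvol
  have hdiff := twoSpacing_smearedLetter_of_prop39 T hL hC' hδ₀ hγ1 h39 Tpq w hw hB hr0 hr hvol
  have hL1 : 1 ≤ T.lo.L := by omega
  -- `L^{−γk} ≤ 1`
  have hθ : (T.lo.L : ℝ) ^ (-(γ * T.lo.k)) ≤ 1 := by
    rw [rpow_neg_mul_natCast]
    obtain ⟨h0, h1⟩ := theta_pos_le_one hL1 hγ0
    exact pow_le_one₀ h0.le h1
  have hsplit : ∑ j ∈ Finset.range T.lo.k, ∑ p ∈ Tpq, w p * T.hi.G j p.1 p.2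
      = ∑ j ∈ Finset.range T.lo.k, ∑ p ∈ Tpq, w p * T.lo.G j (T.pt p.1) (T.pt p.2)
        + ∑ j ∈ Finset.range T.lo.k, ∑ p ∈ Tpq, w p * (T.hi.G j p.1 p.2 - T.lo.G j (T.pt p.1) (T.pt p.2)) := by
    rw [← Finset.sum_add_distrib]
    refine Finset.sum_congr rfl fun j _ => ?_
    rw [← Finset.sum_add_distrib]
    exact Finset.sum_congr rfl fun p _ => by ring
  have hBe : 0 ≤ B * Real.exp (-(δ₀ * r)) := by positivity
  rw [hsplit]
  calc |∑ j ∈ Finset.range T.lo.k, ∑ p ∈ Tpq, w p * T.lo.G j (T.pt p.1) (T.pt p.2)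
        + ∑ j ∈ Finset.range T.lo.k, ∑ p ∈ Tpq, w p * (T.hi.G j p.1 p.2 - T.lo.G j (T.pt p.1) (T.pt p.2))|
      ≤ |∑ j ∈ Finset.range T.lo.k, ∑ p ∈ Tpq, w p * T.lo.G j (T.pt p.1) (T.pt p.2)|
        + |∑ j ∈ Finset.range T.lo.k, ∑ p ∈ Tpq, w p * (T.hi.G j p.1 p.2 - T.lo.G j (T.pt p.1) (T.pt p.2))| :=
        abs_add_le _ _
    _ ≤ C * B * Real.exp (-(δ₀ * r)) + C' * (T.lo.L : ℝ) ^ (-(γ * T.lo.k)) * B * Real.exp (-(δ₀ * r)) :=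
        add_le_add hlo hdiff
    _ ≤ C * B * Real.exp (-(δ₀ * r)) + C' * 1 * B * Real.exp (-(δ₀ * r)) := by
        have : C' * (T.lo.L : ℝ) ^ (-(γ * T.lo.k)) * B * Real.exp (-(δ₀ * r))
            = C' * (T.lo.L : ℝ) ^ (-(γ * T.lo.k)) * (B * Real.exp (-(δ₀ * r))) := by ring
        rw [this, show C' * 1 * B * Real.exp (-(δ₀ * r)) = C' * 1 * (B * Real.exp (-(δ₀ * r))) by ring]
        gcongr
    _ = (C + C') * B * Real.exp (-(δ₀ * r)) := by ring

end FineRun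

end Summit.QuantumFields.YangMills.BalabanUVNodes.N18SmearedSliceLetters

end
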